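import Mathlib
import Summits.QuantumFields.QCD.Theorems.PauliWegnerSeaPhaseQuenchedFlavourDecayFibreMomentReduction
import Literature.MathematicalPhysics.QuantumFieldTheory.QCDHeavyQuarkPropagator
import Literature.MathematicalPhysics.QuantumFieldTheory.QCDWickMinorMeasurability

/-!
# The `r = 1` slice of the fibre moment reduction, concretely
(lead c5, line `crossing-split-integrability`, crux stmt-QuantumFields-9151 `PauliWegnerSea.PhaseQuenchedFlavourDecay`)

`fibreMomentReduction` (file `…FibreMomentReduction.lean`) bounds the phase-quenched weight integral of `Ψ^{1+ε}` by that of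
`(A/M_f)^{1+ε}` for any fibre-invariant measurable majorant `A ≥ Ψ·|det D_f|`.  Here `Ψ = ‖(D⁻¹)((f,p),(f,q))‖` is ONE
same-flavour propagator entry — the `r = 1` integrand of the minor-form core `stub_minorMomentsCore` — and
`A(U) = sup_W ‖adj D_f(refit U W) p q‖`, the two-star fibre supremum of the `(p,q)` cofactor: measurable (a supremum of a
jointly continuous bounded family is lower semicontinuous), fibre-invariant, and dominating `Ψ·|det D_f| ≤ ‖adj D_f p q‖`
(`D_f⁻¹ = det⁻¹ · adj` where invertible; the junk inverse `0` or a vanishing determinant elsewhere).  Result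
(`stub_entryMomentFibreBound`): the `(1+ε)`-moment weight integral of a propagator entry is at most `K(N_f, β_max, ε)` times
that of `(sup_W ‖adj_f p q‖ / M_f)^{1+ε}` — crux K1's cofactor-to-determinant ratio, in moment form, outside-averaged.
-/

noncomputable section

namespace Summit.QuantumFields.QCD.Cruxes.PhaseQuenchedFlavourDecay.CrossingSplitIntegrability

open scoped BigOperators ENNReal
open MeasureTheory Filter
open Literature.MathematicalPhysics.QuantumFieldTheory Literature.MathematicalPhysics.QuantumLattice
  Literature.Probability.LatticeModels

/-- **Cofactor domination of a propagator entry**: `‖(D⁻¹)((f,p),(f,q))‖ · |det D_f| ≤ ‖adj(D_f) p q‖` for the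
`N_f`-flavour Wilson–Dirac matrix `D = diracMatrix U mq` and its flavour-`f` block `D_f` (equality where every one-flavour
determinant is non-zero, by `D_f⁻¹ = det⁻¹ · adj`; where one vanishes the left side is `0`, the inverse being the junk `0`
or the determinant factor vanishing). -/
theorem norm_inv_diracMatrix_mul_norm_det_le {L : ℕ} [NeZero L] {Nf : ℕ} (U : GaugeConfig 4 L SU3)
    (mq : Fin Nf → ℝ) (f : Fin Nf) (p q : TorusSite 4 L × Fin 3 × Fin 4) :
    ‖(diracMatrix U mq)⁻¹ (quarkEquiv (f, p)) (quarkEquiv (f, q))‖ *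
        ‖(wilsonDirac (fundamentalRep (Fin 3)) U (mq f) 1).det‖ ≤
      ‖(wilsonDirac (fundamentalRep (Fin 3)) U (mq f) 1).adjugate p q‖ := by
  by_cases hdet : ∀ g, (wilsonDirac (fundamentalRep (Fin 3)) U (mq g) 1).det ≠ 0
  · have hf := hdet f
    rw [inv_diracMatrix_apply_same_flavour U mq hdet f p q, Matrix.inv_def, Matrix.smul_apply, smul_eq_mul,
      Ring.inverse_eq_inv', norm_mul, norm_inv, mul_comm ‖_‖⁻¹, mul_assoc,
      inv_mul_cancel₀ (norm_ne_zero_iff.2 hf), mul_one]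
  · push Not at hdet
    obtain ⟨g, hg⟩ := hdet
    have h0 : (diracMatrix U mq).det = 0 := by
      rw [det_diracMatrix]; exact Finset.prod_eq_zero (Finset.mem_univ g) hg
    have hinv : (diracMatrix U mq)⁻¹ = 0 :=
      Matrix.nonsing_inv_apply_not_isUnit _ (by rw [h0]; exact not_isUnit_zero)
    rw [hinv, Matrix.zero_apply, norm_zero, zero_mul]
    exact norm_nonneg _

/-- Joint continuity of a refitted cofactor: `(W, U) ↦ ‖adj(D_W(refit U W; m)) p q‖` is continuous, where
`refit U W` takes the links satisfying `star` from `W` and the others from `U`. -/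
theorem continuous_norm_adjugate_wilsonDirac_refit {L : ℕ} [NeZero L] (star : Edge 4 L → Prop)
    [DecidablePred star] (m : ℝ) (p q : TorusSite 4 L × Fin 3 × Fin 4) :
    Continuous fun pr : GaugeConfig 4 L SU3 × GaugeConfig 4 L SU3 =>
      ‖(wilsonDirac (fundamentalRep (Fin 3)) (fun e => if star e then pr.1 e else pr.2 e) m 1).adjugate p q‖ := by
  have hρ3 : Continuous (fundamentalRep (Fin 3) : SU3 →* Matrix (Fin 3) (Fin 3) ℂ) :=
    continuous_fundamentalRep (Fin 3)
  have hrefit : Continuous fun pr : GaugeConfig 4 L SU3 × GaugeConfig 4 L SU3 =>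
      (fun e => if star e then pr.1 e else pr.2 e : GaugeConfig 4 L SU3) := by
    refine continuous_pi fun e => ?_
    by_cases he : star e
    · simp only [he, if_true]; exact (continuous_apply e).comp continuous_fst
    · simp only [he, if_false]; exact (continuous_apply e).comp continuous_snd
  exact (((continuous_wilsonDirac (L := L) (fundamentalRep (Fin 3)) hρ3 m 1).comp
    hrefit).matrix_adjugate.matrix_elem p q).norm

/-- **The `r = 1` slice, concretely (Of-form).**  From the fibre moment reduction: the phase-quenched `(1+ε)`-moment
weight integral of ONE same-flavour propagator entry `‖(D⁻¹)((f,p),(f,q))‖^{1+ε}` is bounded by `K` times that of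
`(sup_W ‖adj D_f(refit U W) p q‖ / M_f(U))^{1+ε}` — the two-star fibre supremum of the `(p,q)` cofactor over the tilted
fibre mean of the determinant (`Ψ = ‖G_f(p,q)‖`; `A =` the fibre supremum, measurable as a lower-semicontinuous
function, fibre-invariant, and dominating `Ψ·|det D_f|` by `norm_inv_diracMatrix_mul_norm_det_le`). -/
theorem entryMomentFibreBound_of
    (hFMR : ∀ (Nf : ℕ) (βmax : ℝ), 0 ≤ βmax → ∃ ε₀ : ℝ, 0 < ε₀ ∧ ∀ ε : ℝ, 0 < ε → ε < ε₀ → ∃ K : ℝ, 0 < K ∧ ∀ β : ℝ, 0 ≤ β → β ≤ βmax → ∀ mq : Fin Nf → ℝ, (∀ f, -2 ≤ mq f ∧ mq f ≤ 2) → ∀ (L : ℕ) [NeZero L], 4 ≤ L → ∀ (f : Fin Nf) (x y : TorusSite 4 L) (Ψ A : GaugeConfig 4 L SU3 → ℝ), Measurable Ψ → Measurable A → (∀ U, 0 ≤ Ψ U) → (∀ U, 0 ≤ A U) → let star : Edge 4 L → Prop := fun e => e.1 = x ∨ Site.shift e.1 e.2 = x ∨ e.1 = y ∨ Site.shift e.1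 e.2 = y; let refit : GaugeConfig 4 L SU3 → GaugeConfig 4 L SU3 → GaugeConfig 4 L SU3 := fun U W e => if star e then W e else U e; let Ff : GaugeConfig 4 L SU3 → ℝ := fun U => ‖fermionDet (wilsonDirac (fundamentalRep (Fin 3)) U (mq f) 1)‖; let G : GaugeConfig 4 L SU3 → ℝ := fun U => ∏ g ∈ Finset.univ.erase f, ‖fermionDet (wilsonDirac (fundamentalRep (Fin 3)) U (mq g) 1)‖; let wt : GaugeConfig 4 L SU3 → ℝ := fun U => Real.exp (-(β * wilsonAction (fundamentalRep (Fin 3)) U)); let haar : Measure (GaugeConfig 4 L SU3) := Measure.pi fun _ => haarProbability SU3; let M : GaugeConfig 4 L SU3 → ℝ := fun U => (∫ W, Ff (refit U W) * G (refit U W) * wt (refit U W) ∂haar) / ∫ W, G (refit U W) * wt (refit U W) ∂haar; (∀ U, Ψ U * Ff U ≤ A U) → (∀ U W, A (refit U W) = A U) → ∫⁻ U, ENNReal.ofReal (Ψ U ^ (1 + ε) * (Ff U * G U * wt U)) ∂haar ≤ ENNReal.ofReal K * ∫⁻ U, ENNReal.ofReal ((A U / M U) ^ (1 + ε) * (Ff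 U * G U * wt U)) ∂haar) :
    ∀ (Nf : ℕ) (βmax : ℝ), 0 ≤ βmax → ∃ ε₀ : ℝ, 0 < ε₀ ∧ ∀ ε : ℝ, 0 < ε → ε < ε₀ → ∃ K : ℝ, 0 < K ∧ ∀ β : ℝ, 0 ≤ β → β ≤ βmax → ∀ mq : Fin Nf → ℝ, (∀ f, -2 ≤ mq f ∧ mq f ≤ 2) → ∀ (L : ℕ) [NeZero L], 4 ≤ L → ∀ (f : Fin Nf) (x y : TorusSite 4 L) (p q : TorusSite 4 L × Fin 3 × Fin 4), let star : Edge 4 L → Prop := fun e => e.1 = x ∨ Site.shift e.1 e.2 = x ∨ e.1 = y ∨ Site.shift e.1 e.2 = y; let refit : GaugeConfig 4 L SU3 → GaugeConfig 4 L SU3 → GaugeConfig 4 L SU3 := fun U W e => if star e then W e else U e; let Ff : GaugeConfig 4 L SU3 → ℝ := fun U => ‖fermionDet (wilsonDirac (fundamentalRep (Fin 3)) U (mq f) 1)‖; let G : GaugeConfig 4 L SU3 → ℝ := fun U => ∏ g ∈ Finset.univ.erase f, ‖fermionDet (wilsonDirac (fundamentalRep (Fin 3)) U (mq g) 1)‖;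 let wt : GaugeConfig 4 L SU3 → ℝ := fun U => Real.exp (-(β * wilsonAction (fundamentalRep (Fin 3)) U)); let haar : Measure (GaugeConfig 4 L SU3) := Measure.pi fun _ => haarProbability SU3; let M : GaugeConfig 4 L SU3 → ℝ := fun U => (∫ W, Ff (refit U W) * G (refit U W) * wt (refit U W) ∂haar) / ∫ W, G (refit U W) * wt (refit U W) ∂haar; ∫⁻ U, ENNReal.ofReal (‖(diracMatrix U mq)⁻¹ (quarkEquiv (f, p)) (quarkEquiv (f, q))‖ ^ (1 + ε) * (Ff U * G U * wt U)) ∂haar ≤ ENNReal.ofReal K * ∫⁻ U, ENNReal.ofReal (((⨆ W, ‖(wilsonDirac (fundamentalRep (Fin 3)) (refit U W) (mq f) 1).adjugate p q‖) / M U) ^ (1 + ε) * (Ff U * G U * wt U)) ∂haar := by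
  intro Nf βmax hβmax
  obtain ⟨ε₀, hε₀, hε⟩ := hFMR Nf βmax hβmax
  refine ⟨ε₀, hε₀, fun ε hεpos hεlt => ?_⟩
  obtain ⟨K, hK, hmain⟩ := hε ε hεpos hεlt
  refine ⟨K, hK, ?_⟩
  intro β hβ hββ mq hmq L _ hL f x y p q star refit Ff G wt haar M
  -- the cofactor as a function of (fibre links, outside field), its uniform bound and its fibre supremum
  have ha_cont : Continuous fun pr : GaugeConfig 4 L SU3 × GaugeConfig 4 L SU3 =>
      ‖(wilsonDirac (fundamentalRep (Fin 3)) (refit pr.2 pr.1) (mq f) 1).adjugate p q‖ :=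
    continuous_norm_adjugate_wilsonDirac_refit star (mq f) p q
  obtain ⟨B, hB⟩ : ∃ B : ℝ, ∀ W U : GaugeConfig 4 L SU3,
      ‖(wilsonDirac (fundamentalRep (Fin 3)) (refit U W) (mq f) 1).adjugate p q‖ ≤ B := by
    obtain ⟨B, hB⟩ := isCompact_univ.bddAbove_image ha_cont.continuousOn
    exact ⟨B, fun W U => hB ⟨(W, U), Set.mem_univ _, rfl⟩⟩
  have hbdd : ∀ U : GaugeConfig 4 L SU3, BddAbove (Set.range fun W : GaugeConfig 4 L SU3 =>
      ‖(wilsonDirac (fundamentalRep (Fin 3)) (refit U W) (mq f) 1).adjugate p q‖) := fun U =>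
    ⟨B, by rintro _ ⟨W, rfl⟩; exact hB W U⟩
  have hrefit_self : ∀ U, refit U U = U := by
    intro U; funext e
    by_cases he : star e
    · simp only [refit, if_pos he]
    · simp only [refit, if_neg he]
  have hrefit_refit : ∀ U W W' : GaugeConfig 4 L SU3, refit (refit U W) W' = refit U W' := by
    intro U W W'; funext e
    by_cases he : star e
    · simp only [refit, if_pos he]
    · simp only [refit, if_neg he]
  refine hmain β hβ hββ mq hmq L hL f x y
    (fun U => ‖(diracMatrix U mq)⁻¹ (quarkEquiv (f, p)) (quarkEquiv (f, q))‖)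
    (fun U => ⨆ W, ‖(wilsonDirac (fundamentalRep (Fin 3)) (refit U W) (mq f) 1).adjugate p q‖)
    (measurable_inv_diracMatrix_apply (S := L) mq _ _).norm
    ((lowerSemicontinuous_ciSup hbdd fun W =>
      (ha_cont.comp (Continuous.prodMk_right W)).lowerSemicontinuous).measurable)
    (fun U => norm_nonneg _)
    (fun U => (norm_nonneg _).trans (le_ciSup (hbdd U) U))
    (fun U => ?_) (fun U W => ?_)
  · -- domination `Ψ · |det D_f| ≤ sup_W ‖adj‖`
    refine (norm_inv_diracMatrix_mul_norm_det_le U mq f p q).trans ?_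
    have h := le_ciSup (hbdd U) U
    simpa only [hrefit_self] using h
  · -- fibre invariance of the supremum
    change (⨆ W', ‖(wilsonDirac (fundamentalRep (Fin 3)) (refit (refit U W) W') (mq f) 1).adjugate p q‖) = _
    simp only [hrefit_refit]

/-- Registered stub `stub_entryMomentFibreBound` (crux stmt-QuantumFields-9151, line `crossing-split-integrability`): the
LET-FREE spelling of `entryMomentFibreBound_of fibreMomentReduction`. -/
theorem stub_entryMomentFibreBound :
    ∀ (Nf : ℕ) (βmax : ℝ), 0 ≤ βmax → ∃ ε₀ : ℝ, 0 < ε₀ ∧ ∀ ε : ℝ, 0 < ε → ε < ε₀ → ∃ K : ℝ, 0 < K ∧ ∀ β : ℝ, 0 ≤ β →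
    β ≤ βmax → ∀ mq : Fin Nf → ℝ, (∀ f, -2 ≤ mq f ∧ mq f ≤ 2) → ∀ (L : ℕ) [NeZero L], 4 ≤ L → ∀ (f : Fin Nf) (x y : TorusSite 4 L) (p q : TorusSite 4 L × Fin 3 × Fin 4),
    ∫⁻ U, ENNReal.ofReal (‖(diracMatrix U mq)⁻¹ (quarkEquiv (f, p)) (quarkEquiv (f, q))‖ ^ (1 + ε) * (‖fermionDet (wilsonDirac (fundamentalRep (Fin 3)) U (mq f) 1)‖ *
    (∏ g ∈ Finset.univ.erase f, ‖fermionDet (wilsonDirac (fundamentalRep (Fin 3)) U (mq g) 1)‖) * Real.exp (-(β * wilsonAction (fundamentalRep (Fin 3)) U)))) ∂(Measure.pi fun _ : Edge 4 L =>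
    haarProbability SU3) ≤ ENNReal.ofReal K * ∫⁻ U, ENNReal.ofReal (((⨆ W : GaugeConfig 4 L SU3, ‖(wilsonDirac (fundamentalRep (Fin 3)) (fun e =>
    if e.1 = x ∨ Site.shift e.1 e.2 = x ∨ e.1 = y ∨ Site.shift e.1 e.2 = y then W e else U e) (mq f) 1).adjugate p q‖) /
    ((∫ W, ‖fermionDet (wilsonDirac (fundamentalRep (Fin 3)) (fun e => if e.1 = x ∨ Site.shift e.1 e.2 = x ∨ e.1 = y ∨
    Site.shift e.1 e.2 = y then W e else U e) (mq f) 1)‖ * (∏ g ∈ Finset.univ.erase f, ‖fermionDet (wilsonDirac (fundamentalRep (Fin 3)) (fun e =>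
    if e.1 = x ∨ Site.shift e.1 e.2 = x ∨ e.1 = y ∨ Site.shift e.1 e.2 = y then W e else U e) (mq g) 1)‖) * Real.exp (-(β *
    wilsonAction (fundamentalRep (Fin 3)) (fun e => if e.1 = x ∨ Site.shift e.1 e.2 = x ∨ e.1 = y ∨ Site.shift e.1 e.2 =
    y then W e else U e))) ∂(Measure.pi fun _ : Edge 4 L => haarProbability SU3)) / ∫ W, (∏ g ∈ Finset.univ.erase f,
    ‖fermionDet (wilsonDirac (fundamentalRep (Fin 3)) (fun e => if e.1 = x ∨ Site.shift e.1 e.2 = x ∨ e.1 = y ∨ Site.shift e.1 e.2 =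
    y then W e else U e) (mq g) 1)‖) * Real.exp (-(β * wilsonAction (fundamentalRep (Fin 3)) (fun e => if e.1 = x ∨ Site.shift e.1 e.2 =
    x ∨ e.1 = y ∨ Site.shift e.1 e.2 = y then W e else U e))) ∂(Measure.pi fun _ : Edge 4 L => haarProbability SU3))) ^
    (1 + ε) * (‖fermionDet (wilsonDirac (fundamentalRep (Fin 3)) U (mq f) 1)‖ * (∏ g ∈ Finset.univ.erase f, ‖fermionDet (wilsonDirac (fundamentalRep (Fin 3)) U (mq g) 1)‖) *
    Real.exp (-(β * wilsonAction (fundamentalRep (Fin 3)) U)))) ∂(Measure.pi fun _ : Edge 4 L => haarProbability SU3) :=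
  entryMomentFibreBound_of fibreMomentReduction

end Summit.QuantumFields.QCD.Cruxes.PhaseQuenchedFlavourDecay.CrossingSplitIntegrability

end
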